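import Literature.NumberTheory.Automorphic.IsAutomorphicAE
import Literature.NumberTheory.GaloisRepresentations.SymplecticMultiplier
import Literature.NumberTheory.PAdicHodge.FontaineDpst
import HarnessLib

/-!
# Local–global compatibility at `ℓ = p` for `GL₄` over `ℚ`, in the form "crystalline at `p` ⇒
# `π_p` unramified" (Caraiani 2014, Thm. 1.1; Barnet-Lamb–Gee–Geraghty–Taylor, *Local–global
# compatibility for `l = p`, II*, Thm. 1.1 / Cor. 1.2)

Topic `Literature/NumberTheory/Automorphic`; sibling of `PDAutomorphyLiftingGL4Rational`
(`BLGGT2014_thm421_rat_GL4`), whose binder style is followed symbol for symbol where the two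
overlap.  Cite item of the crux `stmt-Langlands-17765`
(`Summit.Langlands.Langlands.Theses.AbelianSurfaceSerre.SerreGSp4Surjective`), line
`singer-type-evaporation`, stub `stub_ordinaryEndgame` (the endgame at `p`: a crystalline-ordinary
automorphic lift `r ↔ π` of `ρ̄` has `π_p` unramified, so that after a cyclotomic twist `(π, r)`
witnesses the crux's conclusion `RegularOrdinaryModular`).  One NAMED FACT (D-0014),
`Caraiani2014_crystalline_unramified_rat_GL4`, and its proved specialisation to the place above `p`
of an almost-everywhere statement.

## The printed theorems (quoted from the held texts, read 2026-08-17)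

* A. Caraiani, *Monodromy and local-global compatibility for `l = p`*, Algebra & Number Theory 8
  (2014) 1597–1646 [Caraiani2014] (held: arXiv:1202.4683, p. 3), **Theorem 1.1**: "Let
  `n ∈ ℤ_{≥2}` be an integer and `L` be a CM field with complex conjugation `c`. Let `l` be a prime
  of `ℚ` and `ι_l : ℚ̄_l → ℂ` be an isomorphism. Let `Π` be a cuspidal automorphic representation of
  `GL_n(𝔸_L)` satisfying • `Π^∨ ≃ Π ∘ c` • `Π` is cohomological for some irreducible algebraic
  representation `Ξ` of `GL_n(L ⊗_ℚ ℂ)`.  Let `R_l(Π) : Gal(L̄/L) → GL_n(ℚ̄_l)` be the Galois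
  representation associated to `Π` by [Sh, CH]. Let `y` be a place of `L` above `l`. Then we have the
  following isomorphism of Weil-Deligne representations
  `WD(R_l(Π)|_{Gal(L̄_y/L_y)})^{F-ss} ≃ ι_l⁻¹ 𝓛_{n,L_y}(Π_y)`.  Here `𝓛_{n,L_y}(Π_y)` is the image of
  `Π_y` under the local Langlands correspondence, using the geometric normalization; `WD(r)` is the
  Weil-Deligne representation attached to a de Rham `l`-adic representation `r` ...; `F-ss` denotes
  Frobenius semisimplification.  This theorem is proved in [BLGGT1, BLGGT2] in the case when `Π`
  has Shin-regular weight ... and in general up to semisimplification. Our goal is to match up the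
  monodromy operators"; and (ibid.): "We note that Theorem A of [BLGGT2] is stated for an imaginary
  CM field `F`. For our CM field `L` we proceed as on pages 230-231 of [HT] to find a quadratic
  extension `F/L` which is an imaginary CM field, in which `y = y′y″` splits and such that
  `[R_l(Π)|_{Gal(L̄/F)}] = [R_l(BC_{F/L}(Π))]`."
* T. Barnet-Lamb, T. Gee, D. Geraghty, R. Taylor, *Local-global compatibility for `l = p`, II*,
  Ann. Sci. Éc. Norm. Supér. (4) 47 (2014) 165–179 [BarnetlambGeeGeraghtyTaylor2014LocalGlobalII]
  (held: arXiv:1105.2242, pp. 5–6), **Theorem 1.1**: "Let `(Π, χ)` be a RAECSDC automorphic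
  representation of `GL_m(𝔸_F)` and let `ı : ℚ̄_l ≅ ℂ`. If `v ∣ l` is a place of `F`, then
  `ı WD(r_{l,ı}(Π)|_{G_{F_v}})^{F-ss} ≺ rec(Π_v ⊗ |det|^{(1-m)/2})`. Furthermore, if `Π` has
  Shin-regular weight, then `ı WD(r_{l,ı}(Π)|_{G_{F_v}})^{F-ss} ≅ rec(Π_v ⊗ |det|^{(1-m)/2})`", and
  **Corollary 1.2**: "Let `(Π, χ)` be a RAESDC automorphic representation of `GL_m(𝔸_F)` and let
  `ı : ℚ̄_l ≅ ℂ`. If `v ∣ l` is a place of `F`, then [the same two assertions]", which "follows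
  immediately using base change as in Proposition 4.3.1 of [cht]".  Here (ibid., p. 5) `ρ ≺ ρ′`
  means `ρ^{ss} ≅ (ρ′)^{ss}` together with the dominance inequalities
  `m_1(ρ,σ) + … + m_i(ρ,σ) ≤ m_1(ρ′,σ) + … + m_i(ρ′,σ)` on the monodromy partitions.
* Conventions: T. Barnet-Lamb, T. Gee, D. Geraghty, R. Taylor, *Potential automorphy and change of
  weight*, Ann. of Math. 179 (2014) [BarnetlambEtAl2014], §2.1 (held: arXiv:1010.2561, pp. 17–18):
  for `F` totally real, "By a RAESDC (regular, algebraic, essentially self dual, cuspidal)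
  automorphic representation of `GL_n(𝔸_F)` we mean a pair `(π, χ)` where • `π` is a cuspidal
  automorphic representation of `GL_n(𝔸_F)` such that `π_∞` has the same infinitesimal character as
  some irreducible algebraic representation of the restriction of scalars from `F` to `ℚ` of `GL_n`,
  • `χ : 𝔸_F^×/F^× → ℂ^×` is a continuous character such that `χ_v(−1)` is independent of
  `v ∣ ∞`, • and `π ≅ π^∨ ⊗ (χ ∘ det)`.  We will say that `(π, χ)` has level prime to `l` ... if for
  all `v ∣ l` the representation `π_v` is unramified"; "to a RAESDC or RAECSDC representation
  `(π, χ)` of `GL_n(𝔸_F)` we can attach a continuous semi-simple representation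
  `r_{l,ı}(π) : G_F → GL_n(ℚ̄_l)`"; "The representation `r_{l,ı}(π)` is de Rham (crystalline if `π_v`
  is unramified for all `v ∣ l`)"; for `v ∤ l`,
  "`ı WD(r_{l,ı}(π)|_{G_{F_v}})^{F-ss} ≅ rec(π_v ⊗ |det|_v^{(1−n)/2})`".

So, over `ℚ` (one infinite place: the parity condition on `χ` is void), for `n = 4`: if `(π, χ)`
is RAESDC on `GL₄(𝔸_ℚ)` and `r_{p,ı}(π)|_{G_{ℚ_p}}` is crystalline, then `WD(r_{p,ı}(π)|_{G_{ℚ_p}})`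
is unramified with `N = 0`, hence so is `rec(π_p ⊗ |det|_p^{-3/2})` (Cor. 1.2 gives
`≺`, i.e. the same semisimplification; Caraiani's Thm. 1.1 — applied, as in the deduction of
Cor. 1.2, to the conjugate self-dual twist of the base change of `π` to an imaginary quadratic field
in which `p` splits, [CHT] Prop. 4.3.1, restriction to `W_{ℚ_p} = W_{E_w}` being compatible with
`rec` and with `WD` — upgrades it to an `F-ss` isomorphism, i.e. matches `N`), so `π_p ⊗ |det|^{-3/2}`,
and with it `π_p`, is the unramified (spherical) constituent of an unramified principal series:
`π_p` is unramified.  (The converse, "`π_p` unramified ⇒ crystalline", is the quoted clause of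
[BLGGT] §2.1 and is not the content here.)

## Rendering in the tree's vocabulary (read before reviewing)

Binders follow the sibling `BLGGT2014_thm421_rat_GL4`: `r : Γ_ℚ → GL₄(ℚ̄_p)` continuous
(`FramedGaloisRep`), automorphic representations are `CuspidalAutomorphicRepData 4 ℚ hcpt` (the
named fact `hcpt : isCompact_glFiniteIntegralLevel 4 ℚ` only TYPES `π`, `∀ hcpt`).

* **`π` regular algebraic, `r ≅ r_{p,ı}(π)`.**  `π.1.IsRegularAlgebraic` (Clozel: `π_∞` has the
  infinitesimal character of an algebraic representation and is regular) and `r` is attached to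
  `(π, ι)` at almost all finite places in the Harris–Lan–Taylor–Thorne normalisation `m = 4` of the
  accepted `arithFrobPolyOfSatake` (arithmetic Frobenius; `∏ (X − ι⁻¹(q_v^{3/2} α_j)⁻¹)` for the
  Satake parameter `α` of `π_v`), which is the normalisation `rec(π_v ⊗ |det|_v^{(1−n)/2})` of
  [BLGGT] §2.1 for `r_{l,ı}(π)`; `r` is IRREDUCIBLE (`toGaloisRep.IsIrreducible`), so that `r` and
  the semisimple `r_{p,ı}(π)`, having the same Frobenius polynomials at almost all places, are
  isomorphic (Chebotarev, Brauer–Nesbitt).  This is verbatim the clause `AutomorphicAE` of the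
  requesting line.
* **`(π, χ)` RAESDC, rendered on the Galois side** (as in the sibling): `r` is SYMPLECTIC WITH
  MULTIPLIER `ε_p⁻¹` (`IsSymplecticWithMultiplierFun` for the explicit multiplier
  `g ↦ ε_p(g)⁻¹ ∈ ℚ̄_p`).  Why this gives essential self-duality of `π`: `r^∨ ≅ r ⊗ ε_p`, so
  `r_{p,ı}(π^∨) = r_{p,ı}(π)^∨ ε_p^{1−n} ≅ r ⊗ ε_p^{−2} = r_{p,ı}(π ⊗ |det|^{−2})`
  (`r_{p,ı}(|·|) = ε_p`), hence `π^∨` and `π ⊗ |det|^{−2}` have the same Satake parameters at almost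
  all places and `π^∨ ≅ π ⊗ |det|^{−2}` by strong multiplicity one (Jacquet–Shalika 1981, Thm. 4.8):
  `(π, |·|²)` is RAESDC.
  -- TODO(general form): the automorphic-side datum "(π, χ) RAESDC" (tree `IsGalConjEssSelfDual`)
  -- instead of "`r` symplectic"; general multiplier `μ`; the `GO_n` case.
* **"`r_{p,ı}(π)|_{G_{ℚ_p}}` crystalline"**: `IsCrystallineFramed` of `r|_{Γ_{ℚ_v}} = r.toLocal v` for
  Fontaine's pinned datum `fontainePstAdicCompletion v p hv` at the place `v ∣ p` of `ℚ` (the idiom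
  of the sibling's Fontaine–Laffaille clause and of the requesting line).
* **"`π_p` is unramified"**: the accepted `π.1.IsUnramifiedAt v` (a Satake parameter at `v`: a
  vector fixed by a principal congruence subgroup of level prime to `v` on which the Hecke operators
  at `v` act by scalars, i.e. `π_v` spherical), the idiom by which the sibling renders "level prime
  to `l`".
  -- TODO(general form): totally real / CM base field, general `n`; the full `F-ss` isomorphism
  -- `ı WD(r_{l,ı}(π)|_{G_{F_v}})^{F-ss} ≅ rec(π_v ⊗ |det|^{(1−n)/2})` (needs Fontaine's `WD = D_pst`
  -- functor and `rec` in the tree; the tree's `PstWeilDeligneData` is abstract).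

Also proved here: `Caraiani2014_crystalline_unramified_rat_GL4.isUnramifiedAt_of_forall`, the form
consumed by the line (crystallinity packaged as a `∀ v ∣ p` clause).

## References

* A. Caraiani, Algebra & Number Theory 8 (2014) 1597–1646, Thm. 1.1 (arXiv:1202.4683 p. 3).
  [Caraiani2014]
* T. Barnet-Lamb, T. Gee, D. Geraghty, R. Taylor, Ann. Sci. Éc. Norm. Supér. 47 (2014) 165–179,
  Thm. 1.1, Cor. 1.2 (arXiv:1105.2242 pp. 5–6). [BarnetlambGeeGeraghtyTaylor2014LocalGlobalII]
* T. Barnet-Lamb, T. Gee, D. Geraghty, R. Taylor, Ann. of Math. 179 (2014) 501–609, §2.1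
  (arXiv:1010.2561 pp. 17–18). [BarnetlambEtAl2014]
* L. Clozel, M. Harris, R. Taylor, Publ. Math. IHÉS 108 (2008), Prop. 4.3.1 (base change
  construction of `r_{l,ı}(π)` for RAESDC `π`). [ClozelHarrisTaylor2008]
* H. Jacquet, J. Shalika, Amer. J. Math. 103 (1981), Thm. 4.8 (strong multiplicity one).
  [JacquetShalika1981]
-/

noncomputable section

open scoped MatrixGroups Matrix NumberField
open NumberField IsDedekindDomain Field Filter

namespace Literature.NumberTheory.Automorphic

open Literature.NumberTheory.GaloisRepresentations Literature.NumberTheory.PAdicHodge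

/-- **Caraiani 2014, Theorem 1.1 (with Barnet-Lamb–Gee–Geraghty–Taylor, *Local–global
compatibility for `l = p`, II*, Thm. 1.1 / Cor. 1.2), for `GL₄` over `ℚ`, in the form
"`r_{p,ı}(π)` crystalline at `p` ⇒ `π_p` unramified"** (see the module docstring for the printed
statements and for the rendering, hypothesis by hypothesis).
Let `p` be prime, `π` a regular algebraic (Clozel) cuspidal automorphic representation of
`GL₄(𝔸_ℚ)`, `ι : ℚ̄_p ≃ ℂ`, and `r : Γ_ℚ → GL₄(ℚ̄_p)` continuous, IRREDUCIBLE, SYMPLECTIC WITH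
MULTIPLIER `ε_p⁻¹` (so that `π ≅ π^∨ ⊗ |det|^{-2}` is essentially self-dual, by strong multiplicity
one) and attached to `(π, ι)` at almost all places in the Harris–Lan–Taylor–Thorne normalisation
(`arithFrobPolyOfSatake ι q_v 4`; so `r ≅ r_{p,ı}(π)` by Chebotarev and Brauer–Nesbitt).  If
`r|_{Γ_{ℚ_v}}` is CRYSTALLINE at the place `v ∣ p` (Fontaine's pinned datum), then `π` is unramified
at `v`: `WD(r|_{G_{ℚ_p}})` is unramified with `N = 0`, hence, by the `F-ss` local–global
compatibility at `ℓ = p` (Caraiani; [BLGGT, `l = p` II] Cor. 1.2 for the passage to RAESDC `π` over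
the totally real field `ℚ` by base change to an imaginary quadratic field, [CHT] Prop. 4.3.1), so is
`rec(π_p ⊗ |det|_p^{-3/2})`, i.e. `π_p` is spherical.  Named fact (D-0014), `∀ hcpt`.
-- TODO(general form): totally real / CM `F`, general `n`, the full `F-ss` isomorphism
-- `ı WD(r_{l,ı}(π)|_{G_{F_v}})^{F-ss} ≅ rec(π_v ⊗ |det|^{(1-n)/2})`, `(π, χ)` RAESDC on the
-- automorphic side, general multiplier.
[cite: Caraiani2014, Thm. 1.1] [cite: BarnetlambGeeGeraghtyTaylor2014LocalGlobalII, Thm. 1.1 and Cor. 1.2] [cite: BarnetlambEtAl2014, §2.1] -/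
def Caraiani2014_crystalline_unramified_rat_GL4 : Prop :=
  ∀ (p : ℕ) [Fact p.Prime] (hcpt : isCompact_glFiniteIntegralLevel 4 ℚ)
    (π : CuspidalAutomorphicRepData 4 ℚ hcpt) (ι : PadicAlgCl p ≃+* ℂ)
    (r : FramedGaloisRep ℚ (PadicAlgCl p) 4),
    -- `π` is regular algebraic (Clozel)
    π.1.IsRegularAlgebraic →
    -- `r` is irreducible
    r.toGaloisRep.IsIrreducible →
    -- `r` is symplectic with multiplier `ε_p⁻¹` (so `π` is essentially self-dual, see above)
    r.IsSymplecticWithMultiplierFun (fun g => algebraMap ℚ_[p] (PadicAlgCl p)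
      ((((GaloisRep.cyclotomicCharacter ℚ p g)⁻¹ : ℤ_[p]ˣ) : ℤ_[p]) : ℚ_[p])) →
    -- `r ≅ r_{p,ı}(π)`: Satake–Frobenius compatible at almost all places, `m = 4`
    (∀ᶠ v : HeightOneSpectrum (𝓞 ℚ) in cofinite, ∃ a : Multiset ℂ,
      π.1.HasSatakeParamAt v a ∧ r.IsUnramifiedAt v ∧
        r.HasFrobCharpolyAt v (arithFrobPolyOfSatake ι v.residueCard 4 a)) →
    -- at the place `v ∣ p`: crystalline ⇒ `π_v` unramified
    ∀ (v : HeightOneSpectrum (𝓞 ℚ)) (hv : ((p : ℕ) : 𝓞 ℚ) ∈ v.asIdeal),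
      (fontainePstAdicCompletion v p hv).IsCrystallineFramed (r.toLocal v) → π.1.IsUnramifiedAt v

/-- The form consumed by the requesting line: with crystallinity at every `v ∣ p` packaged as a
`∀ v, p ∈ v → …` clause (e.g. the first conjunct of the line's `IsCrystallineWithWeightsAt`), `π` is
unramified at every place above `p` ("`(π, χ)` has level prime to `p`"). [folklore] -/
theorem Caraiani2014_crystalline_unramified_rat_GL4.isUnramifiedAt_of_forall
    (h : Caraiani2014_crystalline_unramified_rat_GL4) {p : ℕ} [Fact p.Prime]
    {hcpt : isCompact_glFiniteIntegralLevel 4 ℚ} {π : CuspidalAutomorphicRepData 4 ℚ hcpt}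
    {ι : PadicAlgCl p ≃+* ℂ} {r : FramedGaloisRep ℚ (PadicAlgCl p) 4}
    (hRA : π.1.IsRegularAlgebraic) (hirr : r.toGaloisRep.IsIrreducible)
    (hsymp : r.IsSymplecticWithMultiplierFun (fun g => algebraMap ℚ_[p] (PadicAlgCl p)
      ((((GaloisRep.cyclotomicCharacter ℚ p g)⁻¹ : ℤ_[p]ˣ) : ℤ_[p]) : ℚ_[p])))
    (hsat : ∀ᶠ v : HeightOneSpectrum (𝓞 ℚ) in cofinite, ∃ a : Multiset ℂ,
      π.1.HasSatakeParamAt v a ∧ r.IsUnramifiedAt v ∧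
        r.HasFrobCharpolyAt v (arithFrobPolyOfSatake ι v.residueCard 4 a))
    (hcrys : ∀ (v : HeightOneSpectrum (𝓞 ℚ)) (hv : ((p : ℕ) : 𝓞 ℚ) ∈ v.asIdeal),
      (fontainePstAdicCompletion v p hv).IsCrystallineFramed (r.toLocal v)) :
    ∀ v : HeightOneSpectrum (𝓞 ℚ), ((p : ℕ) : 𝓞 ℚ) ∈ v.asIdeal → π.1.IsUnramifiedAt v :=
  fun v hv => h p hcpt π ι r hRA hirr hsymp hsat v hv (hcrys v hv)

end Literature.NumberTheory.Automorphic

end
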